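import Literature.NumberTheory.EllipticCurves.ProfiniteGroupDistributionGlueIntegral
import Literature.NumberTheory.EllipticCurves.ProfiniteGroupDistributionInduction
import HarnessLib

/-!
# Bounded distributions on a group along a subgroup tower: COARSENING THE INDUCED MEASURE — de Shalit's
# III.1.2 (ii) left square `π_{𝔤,𝔣} ∘ i(𝔤) = i(𝔣) ∘ N_{𝔤,𝔣}` on the measure side (`(id)_* i′(b′) = i(N b′)`)

Topic `NumberTheory/EllipticCurves`; namespace `Literature.NumberTheory.EllipticCurves`.

De Shalit, *Iwasawa theory of elliptic curves with complex multiplication* (1987), III.1.2 Lemma (ii) (p. 89):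
for `𝔣 ∣ 𝔤` the diagram `𝒰(𝔤) →^{i(𝔤)} Λ(𝔤)`, `N_{𝔤,𝔣} ↓`, `↓ π_{𝔤,𝔣}`, `𝒰(𝔣) →^{i(𝔣)} Λ(𝔣)` commutes ("follows from
the definitions"); II.4.12 (ii)/(34) and II.4.14 Step 1 (p. 71): this compatibility of the `μ_𝔞 = i(e(𝔞))` across the
moduli `𝔣_m = 𝔤𝔭̄^{m+1}` is what makes the measures `μ(𝔣_m)` glue — the hypothesis `hcompat` of
`exists_glue_twisting_μ_eq_forall_of_units` / `…_seriesFamily`.  This file proves the measure-side content for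
`i := induce` along a FINE tower `𝒰′` (modulus `𝔤`) coarsened to `𝒰` (modulus `𝔣`, `U′_n ≤ U_n`, `id`-compatible):

* §1 `pushforward_μ_smul_of_mem` — for a `G`-equivariant family `i′`, **`(id)_* i′(τ•b) = (id)_* i′(b)` at level `n`
  whenever `τ ∈ U_n`** (the conjugates over `K(𝔣𝔭^∞)` become invisible after coarsening);
* §2 `μ_finset_prod_smul`, `pushforward_μ_finset_prod_smul` — additivity over a product of conjugates:
  **`(id)_* i′(∏_{τ∈T} τ•b) = |T| · (id)_* i′(b)`** for `T ⊆ U_n`;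
* §3 ★ `pushforward_induce_μ_eq_card_mul` — for families `D′` (along `𝒰′`) and `D` (along `𝒰`) reading the SAME
  local measures through a `G`-map `ι : B → B′` (`D′_{ι y} = D_y` on the cells inside `U′_0`):
  **`((id)_* induce D′ (ι y))_n(a) = #{a′ ↦ a} · (induce D y)_n(a)`** (each of the `[U_n : U′_n]` fine cells over `a`
  contributes `(induce D y)_n(a)`, by the `U_0`-equivariance of `D`);
* §4 ★★ `pushforward_induce_μ_eq_induce_norm` — **`(id)_* i′(b′) = i(N b′)`** levelwise, as soon as the "norm"
  `N : B′ → B` satisfies `ι(N b′) = ∏_{τ∈T} τ•b′` for a finite `T ⊆ ⋂_n U_n` with `|T| = #{a′ ↦ a}` for all cells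
  (`𝕜` of characteristic `0`) — the `hcompat` of the glue, reduced to the norm relation of the units
  (`N e_{m+1}(𝔞) = e_m(𝔞)`, II.2.5) and the functoriality of the local measures under the base extension (`D′_{ι y} = D_y`).

Everything is a theorem; no named facts, no instances, no `sorry`.

## References

* [deShalit1987] E. de Shalit, *Iwasawa theory of elliptic curves with complex multiplication* (1987),
  III.1.2 Lemma (ii) (p. 89), II.4.12 (ii) (34) (p. 67), II.4.14 Step 1 (p. 71), I.3.8 (16) (p. 20).
-/

noncomputable section

open Filter
open scoped Topology Classical

namespace Literature.NumberTheory.EllipticCurves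

namespace GroupDistribution

variable {G : Type*} [Group G] {𝒰' 𝒰 : SubgroupTower G} [∀ n, (𝒰'.U n).Normal] [∀ n, (𝒰.U n).Normal]
  (hφ : ∀ n, 𝒰'.U n ≤ (𝒰.U n).comap (MonoidHom.id G))
  {𝕜 : Type*} [NormedField 𝕜] [IsUltrametricDist 𝕜]

/-! ### §1. Conjugation by `τ ∈ U_n` is invisible after coarsening to `𝒰` -/

/-- **`(id)_* i′(τ • b) = (id)_* i′(b)` at level `n` for `τ ∈ U_n`**, for any `G`-equivariant family `i′` along the
fine tower. [cite: deShalit1987, III.1.2 (ii) (p. 89), I.3.8 (16) (p. 20)] -/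
theorem pushforward_μ_smul_of_mem {B' : Type*} [MulAction G B'] (i' : B' → GroupDistribution 𝒰' 𝕜)
    (hi' : ∀ (γ : G) (b : B') (n : ℕ) (a : G ⧸ 𝒰'.U n), (i' (γ • b)).μ n (𝒰'.proj n γ * a) = (i' b).μ n a)
    {τ : G} {n : ℕ} (hτ : τ ∈ 𝒰.U n) (b : B') (a : G ⧸ 𝒰.U n) :
    ((i' (τ • b)).pushforward (MonoidHom.id G) hφ).μ n a = ((i' b).pushforward (MonoidHom.id G) hφ).μ n a := by
  rw [pushforward_μ, pushforward_μ]
  have hτ1 : 𝒰.proj n τ = 1 := by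
    rw [SubgroupTower.proj_apply, QuotientGroup.eq_one_iff]; exact hτ
  refine Finset.sum_nbij' (fun a' ↦ (𝒰'.proj n τ)⁻¹ * a') (fun a' ↦ 𝒰'.proj n τ * a') (fun a' ha' ↦ ?_)
    (fun a' ha' ↦ ?_) (fun a' _ ↦ by rw [mul_inv_cancel_left]) (fun a' _ ↦ by rw [inv_mul_cancel_left])
    (fun a' _ ↦ ?_)
  · refine Finset.mem_filter.mpr ⟨𝒰'.mem_cells _ _, ?_⟩
    rw [SubgroupTower.homCellMap_mul, SubgroupTower.homCellMap_inv, SubgroupTower.homCellMap_proj,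
      MonoidHom.id_apply, hτ1, inv_one, one_mul]
    exact (Finset.mem_filter.mp ha').2
  · refine Finset.mem_filter.mpr ⟨𝒰'.mem_cells _ _, ?_⟩
    rw [SubgroupTower.homCellMap_mul, SubgroupTower.homCellMap_proj, MonoidHom.id_apply, hτ1, one_mul]
    exact (Finset.mem_filter.mp ha').2
  · have h := hi' τ b n ((𝒰'.proj n τ)⁻¹ * a')
    rw [mul_inv_cancel_left] at h
    exact h

/-! ### §2. Additivity over a product of conjugates -/

omit [∀ n, (𝒰'.U n).Normal] [IsUltrametricDist 𝕜] in
/-- `i′(∏_{τ ∈ T} τ • b) = Σ_{τ ∈ T} i′(τ • b)` levelwise, for an additive family with `i′(1) = 0`.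
[cite: deShalit1987, I.3.4 Lemma (i) (p. 18)] -/
theorem μ_finset_prod_smul {B' : Type*} [CommMonoid B'] [MulAction G B'] (i' : B' → GroupDistribution 𝒰' 𝕜)
    (hi'_mul : ∀ (b b' : B') (n : ℕ) (a : G ⧸ 𝒰'.U n), (i' (b * b')).μ n a = (i' b).μ n a + (i' b').μ n a)
    (hi'_one : ∀ (n : ℕ) (a : G ⧸ 𝒰'.U n), (i' 1).μ n a = 0)
    (T : Finset G) (b : B') (n : ℕ) (a : G ⧸ 𝒰'.U n) :
    (i' (∏ τ ∈ T, τ • b)).μ n a = ∑ τ ∈ T, (i' (τ • b)).μ n a := by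
  induction T using Finset.induction_on with
  | empty => rw [Finset.prod_empty, Finset.sum_empty, hi'_one]
  | insert τ T hτ ih => rw [Finset.prod_insert hτ, Finset.sum_insert hτ, hi'_mul, ih]

/-- **`(id)_* i′(∏_{τ∈T} τ • b) = |T| · (id)_* i′(b)` at level `n`** when `T ⊆ U_n`.
[cite: deShalit1987, III.1.2 (ii) (p. 89)] -/
theorem pushforward_μ_finset_prod_smul {B' : Type*} [CommMonoid B'] [MulAction G B']
    (i' : B' → GroupDistribution 𝒰' 𝕜)
    (hi' : ∀ (γ : G) (b : B') (n : ℕ) (a : G ⧸ 𝒰'.U n), (i' (γ • b)).μ n (𝒰'.proj n γ * a) = (i' b).μ n a)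
    (hi'_mul : ∀ (b b' : B') (n : ℕ) (a : G ⧸ 𝒰'.U n), (i' (b * b')).μ n a = (i' b).μ n a + (i' b').μ n a)
    (hi'_one : ∀ (n : ℕ) (a : G ⧸ 𝒰'.U n), (i' 1).μ n a = 0)
    (T : Finset G) {n : ℕ} (hT : ∀ τ ∈ T, τ ∈ 𝒰.U n) (b : B') (a : G ⧸ 𝒰.U n) :
    ((i' (∏ τ ∈ T, τ • b)).pushforward (MonoidHom.id G) hφ).μ n a =
      (T.card : 𝕜) * ((i' b).pushforward (MonoidHom.id G) hφ).μ n a := by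
  rw [pushforward_μ]
  have h1 : ∀ a' ∈ (𝒰'.cells n).filter (fun a' ↦ SubgroupTower.homCellMap 𝒰' 𝒰 (MonoidHom.id G) hφ n a' = a),
      (i' (∏ τ ∈ T, τ • b)).μ n a' = ∑ τ ∈ T, (i' (τ • b)).μ n a' :=
    fun a' _ ↦ μ_finset_prod_smul i' hi'_mul hi'_one T b n a'
  rw [Finset.sum_congr rfl h1, Finset.sum_comm]
  have h2 : ∀ τ ∈ T, ∑ a' ∈ (𝒰'.cells n).filter
      (fun a' ↦ SubgroupTower.homCellMap 𝒰' 𝒰 (MonoidHom.id G) hφ n a' = a), (i' (τ • b)).μ n a' =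
      ((i' b).pushforward (MonoidHom.id G) hφ).μ n a := by
    intro τ hτ
    rw [← pushforward_μ]
    exact pushforward_μ_smul_of_mem hφ i' hi' (hT τ hτ) b a
  rw [Finset.sum_congr rfl h2, Finset.sum_const, nsmul_eq_mul]

/-! ### §3. Coarsening the induced measure of an INCLUDED unit: each fine cell over `a` contributes `i(y)(a)` -/

variable {B B' : Type*} [MulAction G B] [MulAction G B']
  (D' : B' → GroupDistribution 𝒰' 𝕜) {C' : ℝ} (hC0' : 0 ≤ C') (hC' : ∀ b, (D' b).bound ≤ C')
  (hD' : ∀ h ∈ 𝒰'.U 0, ∀ (b : B') (n : ℕ) (a : G ⧸ 𝒰'.U n), 𝒰'.transLE (Nat.zero_le n) a = 1 →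
    (D' (h • b)).μ n (𝒰'.proj n h * a) = (D' b).μ n a)
  (D : B → GroupDistribution 𝒰 𝕜) {C : ℝ} (hC0 : 0 ≤ C) (hC : ∀ b, (D b).bound ≤ C)
  (hD : ∀ h ∈ 𝒰.U 0, ∀ (b : B) (n : ℕ) (a : G ⧸ 𝒰.U n), 𝒰.transLE (Nat.zero_le n) a = 1 →
    (D (h • b)).μ n (𝒰.proj n h * a) = (D b).μ n a)
  (ι : B → B') (hι : ∀ (γ : G) (y : B), ι (γ • y) = γ • ι y)
  (hDι : ∀ (y : B) (n : ℕ) (a' : G ⧸ 𝒰'.U n), 𝒰'.transLE (Nat.zero_le n) a' = 1 →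
    (D' (ι y)).μ n a' = (D y).μ n (SubgroupTower.homCellMap 𝒰' 𝒰 (MonoidHom.id G) hφ n a'))

/-- A fine coset representative lies in the top level of the coarse tower relative to the image cell:
`transLE_0 ((r′)̄⁻¹ · (id)(a′)) = 1` for `r′ = cosetRep 𝒰′ n a′`. [cite: deShalit1987, I.3.4 (p. 18)] -/
theorem transLE_proj_cosetRep_inv_mul_homCellMap (n : ℕ) (a' : G ⧸ 𝒰'.U n) :
    𝒰.transLE (Nat.zero_le n) ((𝒰.proj n (cosetRep 𝒰' n a'))⁻¹ *
      SubgroupTower.homCellMap 𝒰' 𝒰 (MonoidHom.id G) hφ n a') = 1 := by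
  have h' := transLE_proj_cosetRep_inv_mul (𝒰 := 𝒰') n a'
  induction a' using QuotientGroup.induction_on with
  | H g =>
    rw [← SubgroupTower.proj_apply, SubgroupTower.homCellMap_proj, MonoidHom.id_apply, ← 𝒰.proj_inv,
      ← 𝒰.proj_mul, 𝒰.transLE_proj, SubgroupTower.proj_apply, QuotientGroup.eq_one_iff]
    rw [← SubgroupTower.proj_apply, ← 𝒰'.proj_inv, ← 𝒰'.proj_mul, 𝒰'.transLE_proj, SubgroupTower.proj_apply,
      QuotientGroup.eq_one_iff] at h'
    have := hφ 0 h'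
    rwa [Subgroup.mem_comap, MonoidHom.id_apply] at this

include hD hι hDι in
/-- ★ **`((id)_* induce D′ (ι y))_n(a) = #{fine cells over a} · (induce D y)_n(a)`**: on a fine cell `a′ ↦ a` the
induced measure reads `D′_{r′⁻¹ • ι y}(r̄′⁻¹ a′) = D_{r′⁻¹ • y}(r̄′⁻¹ a) = (induce D y)(a)` (`G`-equivariance of
`induce D` and `U_0`-equivariance of `D`). [cite: deShalit1987, III.1.2 (ii) (p. 89), I.3.4 (p. 18)] -/
theorem pushforward_induce_μ_eq_card_mul (y : B) (n : ℕ) (a : G ⧸ 𝒰.U n) :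
    ((induce D' hC0' hC' (ι y)).pushforward (MonoidHom.id G) hφ).μ n a =
      (((𝒰'.cells n).filter (fun a' ↦ SubgroupTower.homCellMap 𝒰' 𝒰 (MonoidHom.id G) hφ n a' = a)).card : 𝕜) *
        (induce D hC0 hC y).μ n a := by
  rw [pushforward_μ]
  have h1 : ∀ a' ∈ (𝒰'.cells n).filter (fun a' ↦ SubgroupTower.homCellMap 𝒰' 𝒰 (MonoidHom.id G) hφ n a' = a),
      (induce D' hC0' hC' (ι y)).μ n a' = (induce D hC0 hC y).μ n a := by
    intro a' ha'
    have ha : SubgroupTower.homCellMap 𝒰' 𝒰 (MonoidHom.id G) hφ n a' = a := (Finset.mem_filter.mp ha').2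
    set r' := cosetRep 𝒰' n a' with hr'
    -- the fine side reads `D′_{ι (r′⁻¹ • y)}` on a cell inside `U′_0`, i.e. `D_{r′⁻¹ • y}` on the image cell
    rw [induce_μ, ← hι, hDι _ _ _ (transLE_proj_cosetRep_inv_mul (𝒰 := 𝒰') n a'),
      SubgroupTower.homCellMap_mul, SubgroupTower.homCellMap_inv, SubgroupTower.homCellMap_proj, MonoidHom.id_apply, ha]
    -- the coarse side: `G`-equivariance of `induce D`, then it reads `D` on the cell inside `U_0`
    have hcell := transLE_proj_cosetRep_inv_mul_homCellMap hφ n a'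
    rw [ha] at hcell
    rw [← induce_μ_of_transLE_eq_one D hC0 hC hD (r'⁻¹ • y) n _ hcell, ← 𝒰.proj_inv,
      induce_μ_smul D hC0 hC hD r'⁻¹ y n a]
  rw [Finset.sum_congr rfl h1, Finset.sum_const, nsmul_eq_mul]

end GroupDistribution

/-! ### §4. `(id)_* i′(b′) = i(N b′)` -/

namespace GroupDistribution

variable {G : Type*} [Group G] {𝒰' 𝒰 : SubgroupTower G} [∀ n, (𝒰'.U n).Normal] [∀ n, (𝒰.U n).Normal]
  (hφ : ∀ n, 𝒰'.U n ≤ (𝒰.U n).comap (MonoidHom.id G))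
  {𝕜 : Type*} [NormedField 𝕜] [IsUltrametricDist 𝕜]
  {B B' : Type*} [MulAction G B] [CommMonoid B'] [MulDistribMulAction G B']
  (D : B → GroupDistribution 𝒰 𝕜) {C : ℝ} (hC0 : 0 ≤ C) (hC : ∀ b, (D b).bound ≤ C)
  (hD : ∀ h ∈ 𝒰.U 0, ∀ (b : B) (n : ℕ) (a : G ⧸ 𝒰.U n), 𝒰.transLE (Nat.zero_le n) a = 1 →
    (D (h • b)).μ n (𝒰.proj n h * a) = (D b).μ n a)

include hD in
/-- ★★ **De Shalit's III.1.2 (ii) left square on the measure side**: with `i′ := induce D′` (fine tower),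
`i := induce D` (coarse tower), a "norm" `N : B′ → B` whose defining relation is `ι(N b′) = ∏_{τ∈T} τ•b′` for a finite
set `T` of conjugating elements lying in EVERY `U_n` and whose cardinality is the number of fine cells over each
coarse cell, **`(id)_* i′(b′) = i(N b′)` levelwise** (`𝕜` of characteristic `0`).  With `N e_{m+1}(𝔞) = e_m(𝔞)`
(II.2.5) this is the compatibility `hcompat` that glues the `μ(𝔣_m)` (II.4.14 Step 1).
[cite: deShalit1987, III.1.2 (ii) (p. 89), II.4.12 (ii) (34) (p. 67), II.4.14 Step 1 (p. 71)] -/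
theorem pushforward_induce_μ_eq_induce_norm [CharZero 𝕜]
    (D' : B' → GroupDistribution 𝒰' 𝕜) {C' : ℝ} (hC0' : 0 ≤ C') (hC' : ∀ b, (D' b).bound ≤ C')
    (hD' : ∀ h ∈ 𝒰'.U 0, ∀ (b : B') (n : ℕ) (a : G ⧸ 𝒰'.U n), 𝒰'.transLE (Nat.zero_le n) a = 1 →
      (D' (h • b)).μ n (𝒰'.proj n h * a) = (D' b).μ n a)
    (hD'add : ∀ (b b' : B') (n : ℕ) (a : G ⧸ 𝒰'.U n), (D' (b * b')).μ n a = (D' b).μ n a + (D' b').μ n a)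
    (ι : B → B') (hι : ∀ (γ : G) (y : B), ι (γ • y) = γ • ι y)
    (hDι : ∀ (y : B) (n : ℕ) (a' : G ⧸ 𝒰'.U n), 𝒰'.transLE (Nat.zero_le n) a' = 1 →
      (D' (ι y)).μ n a' = (D y).μ n (SubgroupTower.homCellMap 𝒰' 𝒰 (MonoidHom.id G) hφ n a'))
    (N : B' → B) (T : Finset G) (hT : ∀ τ ∈ T, ∀ n, τ ∈ 𝒰.U n)
    (hN : ∀ b' : B', ι (N b') = ∏ τ ∈ T, τ • b')
    (hcard : ∀ (n : ℕ) (a : G ⧸ 𝒰.U n),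
      ((𝒰'.cells n).filter (fun a' ↦ SubgroupTower.homCellMap 𝒰' 𝒰 (MonoidHom.id G) hφ n a' = a)).card = T.card)
    (hT0 : T.card ≠ 0) (b' : B') (n : ℕ) (a : G ⧸ 𝒰.U n) :
    ((induce D' hC0' hC' b').pushforward (MonoidHom.id G) hφ).μ n a = (induce D hC0 hC (N b')).μ n a := by
  -- `G`-equivariance, additivity and `i′(1) = 0` for `i′ := induce D′`
  have hi' : ∀ (γ : G) (b : B') (n : ℕ) (a : G ⧸ 𝒰'.U n),
      (induce D' hC0' hC' (γ • b)).μ n (𝒰'.proj n γ * a) = (induce D' hC0' hC' b).μ n a :=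
    fun γ b n a ↦ induce_μ_smul D' hC0' hC' hD' γ b n a
  have hi'_mul : ∀ (b b' : B') (n : ℕ) (a : G ⧸ 𝒰'.U n), (induce D' hC0' hC' (b * b')).μ n a =
      (induce D' hC0' hC' b).μ n a + (induce D' hC0' hC' b').μ n a :=
    fun b b' n a ↦ induce_μ_mul D' hC0' hC' hD'add b b' n a
  have hi'_one : ∀ (n : ℕ) (a : G ⧸ 𝒰'.U n), (induce D' hC0' hC' 1).μ n a = 0 := fun n a ↦ by
    have h := hi'_mul 1 1 n a
    rw [mul_one] at h
    exact left_eq_add.mp h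
  -- `|T| · (id)_* i′(b′) = (id)_* i′(∏ τ•b′) = (id)_* i′(ι (N b′)) = |T| · i(N b′)`
  have h1 := pushforward_μ_finset_prod_smul hφ _ hi' hi'_mul hi'_one T (fun τ hτ ↦ hT τ hτ n) b' a
  rw [← hN, pushforward_induce_μ_eq_card_mul hφ D' hC0' hC' D hC0 hC hD ι hι hDι (N b') n a, hcard n a] at h1
  exact mul_left_cancel₀ (Nat.cast_ne_zero.mpr hT0) h1.symm

end GroupDistribution

end Literature.NumberTheory.EllipticCurves

end
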